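import Summits.BirchSwinnertonDyer.Rank1Residual.GaloisImage.ThreeAdicTowerInertiaCount
import Literature.NumberTheory.EllipticCurves.Kato2004.TorsionNonscalarWitnessProofs
import Literature.NumberTheory.EllipticCurves.SerreOpenImageDeterminantProofs
import HarnessLib

/-!
# The `3`-adic tower from an INERTIA-CARDINALITY GAP at level `9`: `9 ∤ #ρ̄₃(H)`, the criteria
# `27 ∣ #ρ̄₉(H)` / `9 ∣ #ρ̄₉(H) ∧ 3 ∤ #ρ̄₃(H)`, and the valuation sockets (curve-independent;
# cell `b2b-bsdres`, team n1011, row T-b9 'tame tower at `3`' — generic layer, seat p02; part 2 of 2)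

HONEST FRAMING (cell `b2b-bsdres`, run/shared/lean/b2b/bsd-rank1-residual/, verbatim in every
file): the goal of the cell is to DELETE the COMBINATION-SHAPED residual classes of the
Birch–Swinnerton-Dyer formula for ALL analytic-rank `≤ 1` elliptic curves over `ℚ` — "full BSD
formula for every rank `≤ 1` curve in class `C`" assembled STRICTLY from published theorems — so
that the rank-`≤ 1` remainder becomes exactly the CONSTRUCTION-SHAPED classes, which are TYPED
(missing-input `Prop`s), NOT attempted. This is not "finishing BSD". Research route; theorems
only (no definition, no named fact); nothing is booked by this file; no label changes.

## What this file proves (`H ≤ Γ_ℚ` arbitrary — in practice the inertia group `I_𝔓` of the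
prime of `\bar ℤ` over `3`; part 1 = `GaloisImage/ThreeAdicTowerInertiaCount.lean`)

* §3 `card_addAut_geomTorsion_three` (`#Aut(E[3]) = 48`, a frame `Aut(E[3]) ≅ GL₂(𝔽₃)`),
  `not_nine_dvd_card_map_galoisRepTorsion_three` (`9 ∤ #ρ̄_{E,3}(H)`), whence
  `three_mul_card_lt_of_twentySeven_dvd` (`27 ∣ #ρ̄₉(H)` ⟹ `3 · #ρ̄₃(H) < #ρ̄₉(H)`) and
  `three_mul_card_lt_of_nine_dvd_of_not_three_dvd`; the kernel elements non-scalar on `E[9]`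
  follow by part 1 §2.
* §4 THE TOWER: with `ρ̄_{E,3}` onto, any of the above gives `ρ̄_{E,3ⁿ}` onto for every `n`
  (and Kato's (12.5.2) `Kato2004.ImageContainsSL2 W 3`), by the `ζ`-free torsion witness theorem
  `WeierstrassCurve.forall_hasSurjectiveModNGaloisRep_three_pow_of_fixing_torsion_of_nonscalar`
  (`Kato2004/TorsionNonscalarWitnessProofs.lean`: Serre IV-23 with a first-order witness, the
  trace-free form of unit lit-kato) — `forall_hasSurjectiveModNGaloisRep_three_pow_of_surj_of_lt_card`,
  `…_of_twentySeven_dvd`, `…_of_nine_dvd_of_not_three_dvd`, and the VALUATION SOCKETS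
  `…_of_surj_of_valuation` / `…_of_surj_of_valuation_X` (surj(3) + one element / abscissa in
  `ℚ(E[9])` whose valuation has denominator divisible by `27` ⟹ tower — NO hypothesis on the
  reduction type and none on `ρ̄₃`) and `…_of_surj_of_valuation_of_not_three_dvd`
  (denominator divisible by `9` + `3 ∤ #ρ̄₃(I_𝔓)`).

Use (row T-b9, seat p14): at an additive `3` of Kodaira type III / III* the Newton polygons of
`ψ₃` and `ψ₉/ψ₃` give an abscissa of valuation `13/27` (case `v(A₂) = 1`: socket
`…_of_surj_of_valuation_X` with `d = 27`) or `17/36` together with `3 ∤ e₃` (case `v(A₂) ≥ 2`);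
the good supersingular case of Wuthrich's Lemma 20 is `36 ∣ e₉ ∧ e₃ = 8`.  Nothing in this file
depends on the reduction type of `E` at `3`.

References: [SerreAbelianLadic1968] IV-23 Lemma 3; [Serre1972] §4.1 (`Aut(E[ℓ]) ≅ GL₂(𝔽_ℓ)`);
[SerreLocalFields1979] Ch. I §7; [Kato2004Asterisque] (12.5.2) p. 222; [Elkies2006] arXiv:math/0612734.
-/

noncomputable section

open scoped Classical NumberField Pointwise
open Field IsDedekindDomain WeierstrassCurve

namespace Summit.BirchSwinnertonDyer.Rank1Residual.GaloisImage

open Literature.NumberTheory.EllipticCurves Literature.NumberTheory.GaloisRepresentations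
  Rat.HeightOneSpectrum

/-! ### §3 `9 ∤ #ρ̄_{E,3}(H)`: the Sylow `3`-subgroups of `Aut(E[3]) ≅ GL₂(𝔽₃)` have order `3` -/

section Three

variable {W : WeierstrassCurve ℚ} [W.IsElliptic]

/-- **`#Aut(E[3]) = 48`** (`Aut(E[3]) ≅ GL₂(𝔽₃)`, `#GL₂(𝔽₃) = (9 − 1)(9 − 3)`).
[cite: Serre1972, §4.1] -/
theorem card_addAut_geomTorsion_three :
    Nat.card (Multiplicative (AddAut (geomTorsion W ((3 : ℕ) : ℤ)))) = 48 := by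
  haveI : Fact (Nat.Prime 3) := ⟨Nat.prime_three⟩
  obtain ⟨-, Φ, -, -, -, -, -⟩ := exists_frame_galoisRepTorsion_rat W 3
  rw [Nat.card_congr Φ.toEquiv, Matrix.card_GL_field, Fin.prod_univ_two, ZMod.card, Fin.val_zero,
    Fin.val_one, pow_zero, pow_one]
  norm_num

/-- **`#ρ̄_{E,3}(H) ∣ 48`** for every `H ≤ Γ_ℚ`. [cite: Serre1972, §4.1] -/
theorem card_map_galoisRepTorsion_three_dvd (H : Subgroup (absoluteGaloisGroup ℚ)) :
    Nat.card (H.map (galoisRepTorsion W 3)) ∣ 48 := by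
  have h := Subgroup.card_subgroup_dvd_card (H.map (galoisRepTorsion W ((3 : ℕ) : ℤ)))
  rw [card_addAut_geomTorsion_three] at h
  exact_mod_cast h

/-- **`9 ∤ #ρ̄_{E,3}(H)`** for every `H ≤ Γ_ℚ` (`#ρ̄₃(H) ∣ 48`). [cite: Serre1972, §4.1] -/
theorem not_nine_dvd_card_map_galoisRepTorsion_three (H : Subgroup (absoluteGaloisGroup ℚ)) :
    ¬ 9 ∣ Nat.card (H.map (galoisRepTorsion W 3)) := by
  intro h9
  have h48 := card_map_galoisRepTorsion_three_dvd (W := W) H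
  have : 9 ∣ 48 := h9.trans h48
  omega

/-- **`#ρ̄_{E,n}(H) > 0`**: it is the order of a subgroup of the finite group `Gal(ℚ(E[n])/ℚ)`
(the kernel of `Γ_ℚ → Gal(ℚ(E[n])/ℚ)` is the fixer of `E[n]`). [folklore] -/
theorem card_map_galoisRepTorsion_pos (H : Subgroup (absoluteGaloisGroup ℚ)) (n : ℕ) [NeZero n] :
    0 < Nat.card (H.map (galoisRepTorsion W n)) := by
  set L := W.divisionField n with hL
  have hker : (absRestrictNormalHom L).ker = (galoisRepTorsion W n).ker := by
    ext σ
    simp only [MonoidHom.mem_ker]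
    exact (W.absRestrictNormalHom_divisionField_eq_one_iff n σ).trans
      (galoisRepTorsion_eq_one_iff' W n σ).symm
  have hcardA : Nat.card (H.map (absRestrictNormalHom L)) =
      Nat.card (H.map (galoisRepTorsion W n)) := by
    rw [← Subgroup.relIndex_ker, ← Subgroup.relIndex_ker, hker]
  rw [← hcardA]
  haveI : Finite (H.map (absRestrictNormalHom L)) := inferInstance
  exact Nat.card_pos

/-- **`27 ∣ #ρ̄_{E,9}(H)` ⟹ `3 · #ρ̄_{E,3}(H) < #ρ̄_{E,9}(H)`** (`#ρ̄₉ = #C · #ρ̄₃` with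
`9 ∤ #ρ̄₃`, so `9 ∣ #C`). [folklore] -/
theorem three_mul_card_lt_of_twentySeven_dvd (H : Subgroup (absoluteGaloisGroup ℚ))
    (h27 : 27 ∣ Nat.card (H.map (galoisRepTorsion W 9))) :
    3 * Nat.card (H.map (galoisRepTorsion W 3)) < Nat.card (H.map (galoisRepTorsion W 9)) := by
  haveI : Fact (Nat.Prime 3) := ⟨Nat.prime_three⟩
  have hmul := card_map_nine_eq_card_map_inf_ker_mul_card_map_three (W := W) H
  have h9 := not_nine_dvd_card_map_galoisRepTorsion_three (W := W) H
  have hBpos : 0 < Nat.card (H.map (galoisRepTorsion W 9)) := by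
    exact_mod_cast card_map_galoisRepTorsion_pos (W := W) H 9
  set C := Nat.card ((((galoisRepTorsion W 3).ker ⊓ H)).map (galoisRepTorsion W 9)) with hC
  set A := Nat.card (H.map (galoisRepTorsion W 3)) with hA
  set B := Nat.card (H.map (galoisRepTorsion W 9)) with hB
  have hCA0 : C * A ≠ 0 := by rw [hmul]; exact hBpos.ne'
  have hC0 : C ≠ 0 := fun h ↦ hCA0 (by rw [h, zero_mul])
  have hA0 : A ≠ 0 := fun h ↦ hCA0 (by rw [h, mul_zero])
  -- `3`-adic valuations: `v(C) + v(A) ≥ 3`, `v(A) ≤ 1`, hence `v(C) ≥ 2`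
  have h27' : 3 ^ 3 ∣ C * A := by rw [hmul]; norm_num; exact h27
  have hvCA : 3 ≤ padicValNat 3 (C * A) := (padicValNat_dvd_iff_le hCA0).mp h27'
  rw [padicValNat.mul hC0 hA0] at hvCA
  have hvA : padicValNat 3 A ≤ 1 := by
    by_contra hvA
    push Not at hvA
    have h9A : 3 ^ 2 ∣ A := (padicValNat_dvd_iff_le hA0).mpr hvA
    exact h9 (by norm_num at h9A; exact h9A)
  have hC9 : 3 ^ 2 ∣ C := (padicValNat_dvd_iff_le hC0).mpr (by omega)
  obtain ⟨c, hc⟩ := hC9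
  have hc0 : 0 < c := Nat.pos_of_ne_zero (fun h ↦ hC0 (by rw [hc, h, mul_zero]))
  have hApos : 0 < A := Nat.pos_of_ne_zero hA0
  rw [← hmul, hc]
  nlinarith

/-- **`9 ∣ #ρ̄_{E,9}(H)` and `3 ∤ #ρ̄_{E,3}(H)` ⟹ `3 · #ρ̄_{E,3}(H) < #ρ̄_{E,9}(H)`**. [folklore] -/
theorem three_mul_card_lt_of_nine_dvd_of_not_three_dvd (H : Subgroup (absoluteGaloisGroup ℚ))
    (h9 : 9 ∣ Nat.card (H.map (galoisRepTorsion W 9)))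
    (h3 : ¬ 3 ∣ Nat.card (H.map (galoisRepTorsion W 3))) :
    3 * Nat.card (H.map (galoisRepTorsion W 3)) < Nat.card (H.map (galoisRepTorsion W 9)) := by
  have hmul := card_map_nine_eq_card_map_inf_ker_mul_card_map_three (W := W) H
  have hBpos : 0 < Nat.card (H.map (galoisRepTorsion W 9)) := by
    exact_mod_cast card_map_galoisRepTorsion_pos (W := W) H 9
  set C := Nat.card ((((galoisRepTorsion W 3).ker ⊓ H)).map (galoisRepTorsion W 9)) with hC
  set A := Nat.card (H.map (galoisRepTorsion W 3)) with hA
  have hCA0 : C * A ≠ 0 := by rw [hmul]; exact hBpos.ne'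
  have hC0 : C ≠ 0 := fun h ↦ hCA0 (by rw [h, zero_mul])
  have hA0 : A ≠ 0 := fun h ↦ hCA0 (by rw [h, mul_zero])
  have h9' : 9 ∣ C * A := by rw [hmul]; exact h9
  have hcop : Nat.Coprime 9 A := by
    rw [show (9 : ℕ) = 3 ^ 2 by norm_num]
    exact Nat.Coprime.pow_left 2 ((Nat.Prime.coprime_iff_not_dvd Nat.prime_three).mpr h3)
  have hC9 : 9 ∣ C := hcop.dvd_of_dvd_mul_right h9'
  obtain ⟨c, hc⟩ := hC9
  have hc0 : 0 < c := Nat.pos_of_ne_zero (fun h ↦ hC0 (by rw [hc, h, mul_zero]))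
  have hApos : 0 < A := Nat.pos_of_ne_zero hA0
  rw [← hmul, hc]
  nlinarith

/-- **`27 ∣ #ρ̄_{E,9}(H)` ⟹ a kernel element non-scalar on `E[9]`**: some `s ∈ H` fixes `E[3]`
pointwise and is not a scalar `(1 + 3m)·` on `E[9]`.  (No hypothesis on `ρ̄₃(H)`.) [folklore] -/
theorem exists_mem_fixing_three_not_scalar_nine_of_twentySeven_dvd
    (H : Subgroup (absoluteGaloisGroup ℚ)) (h27 : 27 ∣ Nat.card (H.map (galoisRepTorsion W 9))) :
    ∃ s ∈ H, (∀ P ∈ geomTorsion W 3, s • P = P) ∧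
      ¬ ∃ m : ℕ, ∀ Q ∈ geomTorsion W 9, s • Q = (1 + 3 * m) • Q :=
  exists_mem_fixing_three_not_scalar_nine_of_lt_card H (three_mul_card_lt_of_twentySeven_dvd H h27)

/-- **`9 ∣ #ρ̄_{E,9}(H)` and `3 ∤ #ρ̄_{E,3}(H)` ⟹ a kernel element non-scalar on `E[9]`**.
[folklore] -/
theorem exists_mem_fixing_three_not_scalar_nine_of_nine_dvd_of_not_three_dvd
    (H : Subgroup (absoluteGaloisGroup ℚ)) (h9 : 9 ∣ Nat.card (H.map (galoisRepTorsion W 9)))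
    (h3 : ¬ 3 ∣ Nat.card (H.map (galoisRepTorsion W 3))) :
    ∃ s ∈ H, (∀ P ∈ geomTorsion W 3, s • P = P) ∧
      ¬ ∃ m : ℕ, ∀ Q ∈ geomTorsion W 9, s • Q = (1 + 3 * m) • Q :=
  exists_mem_fixing_three_not_scalar_nine_of_lt_card H
    (three_mul_card_lt_of_nine_dvd_of_not_three_dvd H h9 h3)

end Three

/-! ### §4 The tower -/

section Tower

variable (W : WeierstrassCurve ℚ) [W.IsElliptic]

/-- **TOWER CRITERION (cardinality form).**  If `ρ̄_{E,3}` is onto and for some `H ≤ Γ_ℚ` (an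
inertia group at `3`, say) `3 · #ρ̄_{E,3}(H) < #ρ̄_{E,9}(H)`, then `ρ̄_{E,3ⁿ}` is onto for every
`n`: §2 supplies an element trivial on `E[3]` and non-scalar on `E[9]`, and Serre's lifting lemma
with that first-order witness does the rest
(`WeierstrassCurve.forall_hasSurjectiveModNGaloisRep_three_pow_of_fixing_torsion_of_nonscalar`).
[cite: SerreAbelianLadic1968, Ch. IV §3.4, Lemma 3 (IV-23)] -/
theorem forall_hasSurjectiveModNGaloisRep_three_pow_of_surj_of_lt_card
    (hsurj : W.HasSurjectiveModNGaloisRep 3) (H : Subgroup (absoluteGaloisGroup ℚ))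
    (hlt : 3 * Nat.card (H.map (galoisRepTorsion W 3)) < Nat.card (H.map (galoisRepTorsion W 9)))
    (n : ℕ) : W.HasSurjectiveModNGaloisRep (3 ^ n : ℕ) := by
  obtain ⟨s, -, hs3, hs9⟩ := exists_mem_fixing_three_not_scalar_nine_of_lt_card (W := W) H hlt
  exact W.forall_hasSurjectiveModNGaloisRep_three_pow_of_fixing_torsion_of_nonscalar hsurj s hs3
    hs9 n

/-- **TOWER CRITERION, `27 ∣ #ρ̄_{E,9}(H)`**: `ρ̄_{E,3}` onto and `27 ∣ #ρ̄_{E,9}(H)` for some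
`H ≤ Γ_ℚ` ⟹ `ρ̄_{E,3ⁿ}` onto for all `n` (no hypothesis on `ρ̄_{E,3}(H)`: `9 ∤ #ρ̄₃(H)` always).
[cite: SerreAbelianLadic1968, Ch. IV §3.4, Lemma 3 (IV-23)] -/
theorem forall_hasSurjectiveModNGaloisRep_three_pow_of_surj_of_twentySeven_dvd
    (hsurj : W.HasSurjectiveModNGaloisRep 3) (H : Subgroup (absoluteGaloisGroup ℚ))
    (h27 : 27 ∣ Nat.card (H.map (galoisRepTorsion W 9))) (n : ℕ) :
    W.HasSurjectiveModNGaloisRep (3 ^ n : ℕ) :=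
  forall_hasSurjectiveModNGaloisRep_three_pow_of_surj_of_lt_card W hsurj H
    (three_mul_card_lt_of_twentySeven_dvd H h27) n

/-- **TOWER CRITERION, `9 ∣ #ρ̄_{E,9}(H)` and `3 ∤ #ρ̄_{E,3}(H)`** (`ℚ₃(E[3])` tamely ramified
when `H = I_𝔓`): `ρ̄_{E,3}` onto ⟹ `ρ̄_{E,3ⁿ}` onto for all `n`.
[cite: SerreAbelianLadic1968, Ch. IV §3.4, Lemma 3 (IV-23)] -/
theorem forall_hasSurjectiveModNGaloisRep_three_pow_of_surj_of_nine_dvd_of_not_three_dvd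
    (hsurj : W.HasSurjectiveModNGaloisRep 3) (H : Subgroup (absoluteGaloisGroup ℚ))
    (h9 : 9 ∣ Nat.card (H.map (galoisRepTorsion W 9)))
    (h3 : ¬ 3 ∣ Nat.card (H.map (galoisRepTorsion W 3))) (n : ℕ) :
    W.HasSurjectiveModNGaloisRep (3 ^ n : ℕ) :=
  forall_hasSurjectiveModNGaloisRep_three_pow_of_surj_of_lt_card W hsurj H
    (three_mul_card_lt_of_nine_dvd_of_not_three_dvd H h9 h3) n

/-- **TOWER FROM ONE VALUATION (socket for torsion-coordinate computations).**  If `ρ̄_{E,3}` is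
onto and some non-zero `z ∈ ℚ(E[9])` has `v(z)^d · v(3)^a = v(3)^b` for the place `v` of `ℚ̄`
over `3`, with `d` coprime to `a − b` and `27 ∣ d` — i.e. the `3`-adic valuation of `z` has
denominator divisible by `27` — then `ρ̄_{E,3ⁿ}` is onto for every `n`.  No hypothesis on the
reduction of `E` at `3`. (§1 with `H = I_𝔓` for the prime `𝔓` of the place, then
`…_of_twentySeven_dvd`.) [cite: SerreLocalFields1979, Ch. I §7 Cor. to Prop. 21 and Prop. 22(b)]
[cite: SerreAbelianLadic1968, Ch. IV §3.4, Lemma 3 (IV-23)] -/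
theorem forall_hasSurjectiveModNGaloisRep_three_pow_of_surj_of_valuation
    (hsurj : W.HasSurjectiveModNGaloisRep 3) {z : AlgebraicClosure ℚ}
    (hzL : z ∈ W.divisionField 9) (hz0 : z ≠ 0) {d a b : ℕ}
    (hval : (placeOver 3).valuation z ^ d * (placeOver 3).valuation 3 ^ a =
      (placeOver 3).valuation 3 ^ b)
    (hcop : IsCoprime (d : ℤ) ((a : ℤ) - b)) (h27 : 27 ∣ d) (n : ℕ) :
    W.HasSurjectiveModNGaloisRep (3 ^ n : ℕ) := by
  haveI : Fact (Nat.Prime 3) := ⟨Nat.prime_three⟩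
  haveI : NeZero (9 : ℕ) := ⟨by norm_num⟩
  obtain ⟨v, hv⟩ : ∃ v : HeightOneSpectrum (𝓞 ℚ), (primesEquiv v : ℕ) = 3 :=
    ⟨primesEquiv.symm ⟨3, Nat.prime_three⟩, by rw [Equiv.apply_symm_apply]⟩
  obtain ⟨𝔓, hmem, h𝔓⟩ := exists_ideal_placeOver 3 hv
  have hd := dvd_card_inertia_map_galoisRepTorsion_of_valuation (W := W) (n := 9) hv hmem h𝔓 hzL
    hz0 hval hcop
  exact forall_hasSurjectiveModNGaloisRep_three_pow_of_surj_of_twentySeven_dvd W hsurj _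
    (by exact_mod_cast h27.trans hd) n

/-- **TOWER FROM THE VALUATION OF A `9`-TORSION ABSCISSA.**  If `ρ̄_{E,3}` is onto and some
`Q = (x, y) ∈ E[9]` has `v(x)^d · v(3)^a = v(3)^b` (`v` the place over `3`) with `d` coprime to
`a − b` and `27 ∣ d`, then `ρ̄_{E,3ⁿ}` is onto for every `n` — the shape in which the
good-supersingular proof of Wuthrich's Lemma 20 reads `v(x_Q)^{36} v(3) = 1`, here with a
denominator divisible by `27` and nothing assumed about the reduction at `3`.
[cite: SerreLocalFields1979, Ch. I §7 Cor. to Prop. 21 and Prop. 22(b)]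
[cite: SerreAbelianLadic1968, Ch. IV §3.4, Lemma 3 (IV-23)] -/
theorem forall_hasSurjectiveModNGaloisRep_three_pow_of_surj_of_valuation_X
    (hsurj : W.HasSurjectiveModNGaloisRep 3) {Q : W.geomPoints} (hQ : Q ∈ geomTorsion W 9)
    {x y : AlgebraicClosure ℚ}
    {h : (W.map (algebraMap ℚ (AlgebraicClosure ℚ))).toAffine.Nonsingular x y}
    (hQxy : Q = .some (x := x) (y := y) h) (hx0 : x ≠ 0) {d a b : ℕ}
    (hval : (placeOver 3).valuation x ^ d * (placeOver 3).valuation 3 ^ a =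
      (placeOver 3).valuation 3 ^ b)
    (hcop : IsCoprime (d : ℤ) ((a : ℤ) - b)) (h27 : 27 ∣ d) (n : ℕ) :
    W.HasSurjectiveModNGaloisRep (3 ^ n : ℕ) := by
  haveI : NeZero (9 : ℕ) := ⟨by norm_num⟩
  have hQ' : Q ∈ geomTorsion W ((9 : ℕ) : ℤ) := by exact_mod_cast hQ
  obtain ⟨hxL, -⟩ := W.mem_divisionField_of_eq_some (n := 9) (T := ⟨Q, hQ'⟩) hQxy
  exact forall_hasSurjectiveModNGaloisRep_three_pow_of_surj_of_valuation W hsurj hxL hx0 hval hcop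
    h27 n

/-- **TOWER FROM A VALUATION WITH DENOMINATOR DIVISIBLE BY `9` PLUS TAMENESS OF `ρ̄₃` ON
INERTIA.**  With the place data `(v, 𝔓)` over `3` explicit: if `ρ̄_{E,3}` is onto, some non-zero
`z ∈ ℚ(E[9])` has `v(z)^d · v(3)^a = v(3)^b` with `d` coprime to `a − b` and `9 ∣ d`, and
`3 ∤ #ρ̄_{E,3}(I_𝔓)`, then `ρ̄_{E,3ⁿ}` is onto for every `n`.
[cite: SerreLocalFields1979, Ch. I §7 Cor. to Prop. 21 and Prop. 22(b)]
[cite: SerreAbelianLadic1968, Ch. IV §3.4, Lemma 3 (IV-23)] -/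
theorem forall_hasSurjectiveModNGaloisRep_three_pow_of_surj_of_valuation_of_not_three_dvd
    (hsurj : W.HasSurjectiveModNGaloisRep 3)
    {v : HeightOneSpectrum (𝓞 ℚ)} (hv : (primesEquiv v : ℕ) = 3)
    {𝔓 : Ideal (absIntegers (𝓞 ℚ) ℚ)}
    (hmem : ∀ x : absIntegers (𝓞 ℚ) ℚ, x ∈ 𝔓 ↔ (x : AlgebraicClosure ℚ) ∈ (placeOver 3).nonunits)
    (h𝔓 : 𝔓 ∈ v.primesAbove)
    (h3 : ¬ 3 ∣ Nat.card ((𝔓.inertia (absoluteGaloisGroup ℚ)).map (galoisRepTorsion W 3)))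
    {z : AlgebraicClosure ℚ} (hzL : z ∈ W.divisionField 9) (hz0 : z ≠ 0) {d a b : ℕ}
    (hval : (placeOver 3).valuation z ^ d * (placeOver 3).valuation 3 ^ a =
      (placeOver 3).valuation 3 ^ b)
    (hcop : IsCoprime (d : ℤ) ((a : ℤ) - b)) (h9 : 9 ∣ d) (n : ℕ) :
    W.HasSurjectiveModNGaloisRep (3 ^ n : ℕ) := by
  haveI : NeZero (9 : ℕ) := ⟨by norm_num⟩
  have hd := dvd_card_inertia_map_galoisRepTorsion_of_valuation (W := W) (n := 9) hv hmem h𝔓 hzL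
    hz0 hval hcop
  exact forall_hasSurjectiveModNGaloisRep_three_pow_of_surj_of_nine_dvd_of_not_three_dvd W hsurj _
    (by exact_mod_cast h9.trans hd) h3 n

/-- `Nat.Coprime d b` gives `IsCoprime (d : ℤ) ((0 : ℕ) - b)` (the coprimality clause of the
valuation sockets for an identity `v(z)^d = v(3)^b`, i.e. `a = 0`). [folklore] -/
theorem isCoprime_zero_sub_of_coprime {d b : ℕ} (h : Nat.Coprime d b) :
    IsCoprime (d : ℤ) (((0 : ℕ) : ℤ) - b) := by
  rw [Nat.cast_zero, zero_sub]
  exact (Nat.isCoprime_iff_coprime.mpr h).neg_right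

/-- §1 of part 1 for an identity **`v(x)^d = v(3)^b`** (abscissa of an `n`-torsion point, `d`
coprime to `b`): `d ∣ #ρ̄_{E,n}(I_𝔓)`.  (E.g. `v(x_P)^4 = v(3)` for `P ∈ E[3]` gives `4 ∣ #ρ̄₃(I_𝔓)`.)
[cite: SerreLocalFields1979, Ch. I §7 Cor. to Prop. 21 and Prop. 22(b)] -/
theorem dvd_card_inertia_map_galoisRepTorsion_of_valuation_X_pow_eq {n : ℕ} [NeZero n]
    {v : HeightOneSpectrum (𝓞 ℚ)} (hv : (primesEquiv v : ℕ) = 3)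
    {𝔓 : Ideal (absIntegers (𝓞 ℚ) ℚ)}
    (hmem : ∀ x : absIntegers (𝓞 ℚ) ℚ, x ∈ 𝔓 ↔ (x : AlgebraicClosure ℚ) ∈ (placeOver 3).nonunits)
    (h𝔓 : 𝔓 ∈ v.primesAbove)
    {Q : W.geomPoints} (hQ : Q ∈ geomTorsion W n) {x y : AlgebraicClosure ℚ}
    {h : (W.map (algebraMap ℚ (AlgebraicClosure ℚ))).toAffine.Nonsingular x y}
    (hQxy : Q = .some (x := x) (y := y) h) (hx0 : x ≠ 0) {d b : ℕ}
    (hval : (placeOver 3).valuation x ^ d = (placeOver 3).valuation 3 ^ b)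
    (hcop : Nat.Coprime d b) :
    d ∣ Nat.card ((𝔓.inertia (absoluteGaloisGroup ℚ)).map (galoisRepTorsion W n)) :=
  dvd_card_inertia_map_galoisRepTorsion_of_valuation_X (W := W) hv hmem h𝔓 hQ hQxy hx0 (a := 0)
    (b := b) (by rw [pow_zero, mul_one]; exact hval) (isCoprime_zero_sub_of_coprime hcop)

/-- **TOWER FROM `v(x_Q)^d = v(3)^b` WITH `27 ∣ d`** (`Q = (x, y) ∈ E[9]`, `d` coprime to `b`;
e.g. `v(x_Q)^{27} = v(3)^{13}` at an additive `3` of Kodaira type III, case `v(A₂) = 1`):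
`ρ̄_{E,3}` onto ⟹ `ρ̄_{E,3ⁿ}` onto for every `n`.  No hypothesis on the reduction of `E` at `3`
and none on `ρ̄_{E,3}` of inertia.
[cite: SerreLocalFields1979, Ch. I §7 Cor. to Prop. 21 and Prop. 22(b)]
[cite: SerreAbelianLadic1968, Ch. IV §3.4, Lemma 3 (IV-23)] -/
theorem forall_hasSurjectiveModNGaloisRep_three_pow_of_surj_of_valuation_X_pow_eq
    (hsurj : W.HasSurjectiveModNGaloisRep 3) {Q : W.geomPoints} (hQ : Q ∈ geomTorsion W 9)
    {x y : AlgebraicClosure ℚ}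
    {h : (W.map (algebraMap ℚ (AlgebraicClosure ℚ))).toAffine.Nonsingular x y}
    (hQxy : Q = .some (x := x) (y := y) h) (hx0 : x ≠ 0) {d b : ℕ}
    (hval : (placeOver 3).valuation x ^ d = (placeOver 3).valuation 3 ^ b)
    (hcop : Nat.Coprime d b) (h27 : 27 ∣ d) (n : ℕ) :
    W.HasSurjectiveModNGaloisRep (3 ^ n : ℕ) :=
  forall_hasSurjectiveModNGaloisRep_three_pow_of_surj_of_valuation_X W hsurj hQ hQxy hx0 (a := 0)
    (b := b) (by rw [pow_zero, mul_one]; exact hval) (isCoprime_zero_sub_of_coprime hcop) h27 n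

/-- **TOWER FROM `v(x_Q)^d = v(3)^b` WITH `9 ∣ d` AND `3 ∤ #ρ̄_{E,3}(I_𝔓)`** (`Q = (x, y) ∈ E[9]`,
`d` coprime to `b`, the place data `(v, 𝔓)` over `3` explicit; e.g. `v(x_Q)^{36} = v(3)^{17}`
at an additive `3` of Kodaira type III, case `v(A₂) ≥ 2`, where `ℚ₃(E[3])` is tamely
ramified): `ρ̄_{E,3}` onto ⟹ `ρ̄_{E,3ⁿ}` onto for every `n`.
[cite: SerreLocalFields1979, Ch. I §7 Cor. to Prop. 21 and Prop. 22(b)]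
[cite: SerreAbelianLadic1968, Ch. IV §3.4, Lemma 3 (IV-23)] -/
theorem forall_hasSurjectiveModNGaloisRep_three_pow_of_surj_of_valuation_X_pow_eq_of_not_three_dvd
    (hsurj : W.HasSurjectiveModNGaloisRep 3)
    {v : HeightOneSpectrum (𝓞 ℚ)} (hv : (primesEquiv v : ℕ) = 3)
    {𝔓 : Ideal (absIntegers (𝓞 ℚ) ℚ)}
    (hmem : ∀ x : absIntegers (𝓞 ℚ) ℚ, x ∈ 𝔓 ↔ (x : AlgebraicClosure ℚ) ∈ (placeOver 3).nonunits)
    (h𝔓 : 𝔓 ∈ v.primesAbove)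
    (h3 : ¬ 3 ∣ Nat.card ((𝔓.inertia (absoluteGaloisGroup ℚ)).map (galoisRepTorsion W 3)))
    {Q : W.geomPoints} (hQ : Q ∈ geomTorsion W 9) {x y : AlgebraicClosure ℚ}
    {h : (W.map (algebraMap ℚ (AlgebraicClosure ℚ))).toAffine.Nonsingular x y}
    (hQxy : Q = .some (x := x) (y := y) h) (hx0 : x ≠ 0) {d b : ℕ}
    (hval : (placeOver 3).valuation x ^ d = (placeOver 3).valuation 3 ^ b)
    (hcop : Nat.Coprime d b) (h9 : 9 ∣ d) (n : ℕ) :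
    W.HasSurjectiveModNGaloisRep (3 ^ n : ℕ) := by
  haveI : NeZero (9 : ℕ) := ⟨by norm_num⟩
  have hQ' : Q ∈ geomTorsion W ((9 : ℕ) : ℤ) := by exact_mod_cast hQ
  obtain ⟨hxL, -⟩ := W.mem_divisionField_of_eq_some (n := 9) (T := ⟨Q, hQ'⟩) hQxy
  exact forall_hasSurjectiveModNGaloisRep_three_pow_of_surj_of_valuation_of_not_three_dvd W hsurj hv
    hmem h𝔓 h3 hxL hx0 (a := 0) (b := b) (by rw [pow_zero, mul_one]; exact hval)
    (isCoprime_zero_sub_of_coprime hcop) h9 n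

/-- **Kato's (12.5.2) at `3` from the cardinality criterion**: `ρ̄_{E,3}` onto and
`3 · #ρ̄_{E,3}(H) < #ρ̄_{E,9}(H)` for some `H ≤ Γ_ℚ` ⟹ the image of `Gal(ℚ̄/ℚ(ζ_{3^∞}))` in
`Aut(T₃E)` contains `SL₂(ℤ₃)` — the integrality hypothesis of Kato's Thm. 12.5 (4) / 14.5 (3)
(cell binder V20X) on such rows. [cite: Kato2004Asterisque, (12.5.2) (p. 222)]
[cite: SerreAbelianLadic1968, Ch. IV §3.4, Lemma 3 (IV-23)] -/
theorem imageContainsSL2_three_of_surj_of_lt_card (hsurj : W.HasSurjectiveModNGaloisRep 3)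
    (H : Subgroup (absoluteGaloisGroup ℚ))
    (hlt : 3 * Nat.card (H.map (galoisRepTorsion W 3)) < Nat.card (H.map (galoisRepTorsion W 9))) :
    Kato2004.ImageContainsSL2 W 3 := by
  haveI : Fact (Nat.Prime 3) := ⟨Nat.prime_three⟩
  exact (Kato2004.imageContainsSL2_iff_forall_hasSurjectiveModNGaloisRep W 3).mpr
    (forall_hasSurjectiveModNGaloisRep_three_pow_of_surj_of_lt_card W hsurj H hlt)

/-- **Kato's (12.5.2) at `3` from one valuation**: `ρ̄_{E,3}` onto and a non-zero `z ∈ ℚ(E[9])`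
whose `3`-adic valuation has denominator divisible by `27` (in the form
`v(z)^d · v(3)^a = v(3)^b`, `d` coprime to `a − b`, `27 ∣ d`) ⟹ `Kato2004.ImageContainsSL2 W 3`.
[cite: Kato2004Asterisque, (12.5.2) (p. 222)] [cite: SerreAbelianLadic1968, Ch. IV §3.4, Lemma 3 (IV-23)] -/
theorem imageContainsSL2_three_of_surj_of_valuation (hsurj : W.HasSurjectiveModNGaloisRep 3)
    {z : AlgebraicClosure ℚ} (hzL : z ∈ W.divisionField 9) (hz0 : z ≠ 0) {d a b : ℕ}
    (hval : (placeOver 3).valuation z ^ d * (placeOver 3).valuation 3 ^ a =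
      (placeOver 3).valuation 3 ^ b)
    (hcop : IsCoprime (d : ℤ) ((a : ℤ) - b)) (h27 : 27 ∣ d) :
    Kato2004.ImageContainsSL2 W 3 := by
  haveI : Fact (Nat.Prime 3) := ⟨Nat.prime_three⟩
  exact (Kato2004.imageContainsSL2_iff_forall_hasSurjectiveModNGaloisRep W 3).mpr
    (forall_hasSurjectiveModNGaloisRep_three_pow_of_surj_of_valuation W hsurj hzL hz0 hval hcop h27)

end Tower

end Summit.BirchSwinnertonDyer.Rank1Residual.GaloisImage

end
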